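import Literature.Geometry.Lorentzian.LocalCausalityExp
import Literature.Geometry.Lorentzian.KerrSliceFacts
import Literature.Geometry.Lorentzian.NormalisedNullRayCausal
import HarnessLib

/-!
# Initial segments of radial null geodesics are not chronological (O'Neill 1983, Lemma 5.33 ⇒ 14.2 (2))

NoC0KerrChart programme (crux `CaptureSufficesTame`, line `only-the-third-law-is-generic`, stub G at the model
point; lead c10): the one place where the NULL-CONE structure of the exact metric enters the limit argument. For
a time-oriented Lorentzian manifold (Hausdorff, boundaryless finite-dimensional model, smooth metric) and a point
`o`: there are an open neighbourhood `W` of `o` and a neighbourhood `V` of `0` in `T_oM` such that for every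
NULL vector `v ∈ V`, NO future timelike curve INSIDE `W` runs from `o` to `exp_o v`
(`exists_nhds_not_timelike_to_expMap_null`). Proof: read a hypothetical timelike `α` in the exponential chart
at `o` through the two-point inverse `Ξ` of `exists_twoPoint_expInverse` (`β = exp_o⁻¹ ∘ α`, `β a = 0`); since
`d(exp_o)_0 = id` (`velocity_expMap_comp_of_eq_zero`) `β' a = α' a` is future timelike, so `β` enters the open
future timecone right after `a`; O'Neill's Lemma 5.33 (`radial_timecone_invariance`) keeps it there up to `b`,
so `exp_o⁻¹(α b)` is timelike; but `α b = exp_o v` with `v` null and small, and `exp_o` is injective on the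
source ball of the two-point inverse — contradiction.
-/

set_option linter.dupNamespace false

noncomputable section

open Bundle Set Filter Function
open scoped Manifold ContDiff Topology

namespace Summit.FinalStateConjecture.FinalStateConjecture.Theorems.PhaseMixingCaptureCaptureSufficesTame

open Literature.Geometry.Lorentzian Literature.Geometry.Riemannian

namespace NoC0

variable {E : Type*} [NormedAddCommGroup E] [NormedSpace ℝ E] {H : Type*} [TopologicalSpace H]
  {I : ModelWithCorners ℝ E H} {M : Type*} [TopologicalSpace M] [ChartedSpace H M]
  [IsManifold I ∞ M] [FiniteDimensional ℝ E] [CompleteSpace E] [T2Space M] [I.Boundaryless]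
  {n : ℕ∞ω} {g : LorentzianMetric I n M} [g.HasLeviCivita]
  [CovariantDerivative.ContMDiffCovariantDerivative g.leviCivita 1] (τ : TimeOrientation g)

/-- **Initial segments of radial null geodesics are not chronological, locally** (O'Neill 1983, Ch. 5,
Lemma 5.33 and Ch. 14, Lemma 14.2 (2): in a normal neighbourhood `q = exp_p v ∈ I⁺(p)` iff `v` is future
timelike). Every point `o` has an open neighbourhood `W` and a neighbourhood `V` of `0 ∈ T_oM` such that for
every null `v ∈ V` (then `v ∈ 𝓔_o`) there is no future timelike curve inside `W` from `o` to `exp_o v`.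
[cite: ONeillSemiRiemannian1983, Ch. 5, Lemma 5.33 (pp. 146–147); Ch. 14, Lemma 14.2 (p. 402)] -/
theorem exists_nhds_not_timelike_to_expMap_null (hn : (∞ : ℕ∞ω) ≤ n) (o : M) :
    ∃ (W : Set M) (V : Set E), IsOpen W ∧ o ∈ W ∧ V ∈ 𝓝 (0 : E) ∧
      ∀ v ∈ V, (v : TangentSpace I o) ∈ expDomain g.leviCivita o ∧
        (g.IsNull (x := o) v → ∀ (α : ℝ → M) (a b : ℝ), a < b →
          g.IsFutureTimelikeCurveOn τ α (Icc a b) → MapsTo α (Icc a b) W → α a = o →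
          α b = expMap g.leviCivita o (v : TangentSpace I o) → False) := by
  haveI : Fact (1 ≤ n) := ⟨le_trans (by exact_mod_cast le_top) hn⟩
  haveI := contMDiffCovariantDerivative_leviCivita_infty g.toPseudoRiemannianMetric hn
  set cov := g.leviCivita with hcov
  obtain ⟨W, Src, Ξ, hWo, hoW, hWsrc, hSo, hS0, hSdom, hinjF, hΞ, hΞs, -⟩ :=
    exists_twoPoint_expInverse (cov := cov) o
  set e := trivializationAt E (TangentSpace I : M → Type _) o with he
  have hbase : e.baseSet = (chartAt H o).source := TangentBundle.trivializationAt_baseSet o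
  have hoe : o ∈ e.baseSet := by rw [hbase]; exact mem_chart_source H o
  -- the neighbourhood of `0` in `T_oM`: vectors whose chart coordinate lies in the source of the two-point inverse
  set V : Set E := {v : E | (o, e.continuousLinearMapAt ℝ o v) ∈ Src} with hV
  have hVo : IsOpen V := by
    have hc : Continuous fun v : E ↦ ((o, e.continuousLinearMapAt ℝ o v) : M × E) :=
      continuous_const.prodMk (e.continuousLinearMapAt ℝ o).continuous
    exact hSo.preimage hc
  have h0V : (0 : E) ∈ V := by
    show (o, e.continuousLinearMapAt ℝ o 0) ∈ Src
    rw [map_zero]; exact hS0 o hoW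
  refine ⟨W, V, hWo, hoW, hVo.mem_nhds h0V, fun v hv ↦ ?_⟩
  set ξ : E := e.continuousLinearMapAt ℝ o v with hξ
  have hξv : e.symmL ℝ o ξ = v := e.symmL_continuousLinearMapAt hoe v
  have hvdom : (v : TangentSpace I o) ∈ expDomain cov o := by
    have h := (hSdom _ hv).2
    simp only at h
    rwa [hξv] at h
  refine ⟨hvdom, fun hvnull α a b hab hα hαW hαa hαb ↦ ?_⟩
  -- `Ξ o o = 0` (injectivity of the two-point inverse on `Src`)
  have hΞoo : Ξ o o = 0 := by
    have h1 : (o, Ξ o o) ∈ Src := (hΞ o hoW o hoW).1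
    have h2 : (o, (0 : E)) ∈ Src := hS0 o hoW
    have heq : (fun w : M × E ↦ (w.1, expMap cov w.1 (e.symmL ℝ w.1 w.2))) (o, Ξ o o) =
        (fun w : M × E ↦ (w.1, expMap cov w.1 (e.symmL ℝ w.1 w.2))) (o, (0 : E)) := by
      simp only
      rw [(hΞ o hoW o hoW).2, map_zero]
      exact Prod.ext rfl (expMap_zero (cov := cov) o).symm
    exact congrArg Prod.snd (hinjF h1 h2 heq)
  -- (A) the chart curve `β = exp_o⁻¹ ∘ α`
  have hαc : ∀ t ∈ Icc a b, ContinuousAt α t := fun t ht ↦ (hα t ht).1.continuousAt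
  have hαnear : ∀ t ∈ Icc a b, ∀ᶠ s in 𝓝 t, α s ∈ W := fun t ht ↦
    (hαc t ht).preimage_mem_nhds (hWo.mem_nhds (hαW ht))
  set L : E →L[ℝ] E := e.symmL ℝ o with hL
  set K : M → E := fun w ↦ Ξ o w with hK
  have hKs : ContMDiffOn I 𝓘(ℝ, E) ∞ K W := by
    have h1 : ContMDiff I (I.prod I) ∞ (fun w : M ↦ (o, w)) := contMDiff_const.prodMk contMDiff_id
    exact hΞs.comp h1.contMDiffOn fun w hw ↦ ⟨hoW, hw⟩
  set β : ℝ → E := fun t ↦ L (K (α t)) with hβ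
  have hdiff : ∀ t ∈ Icc a b, DifferentiableAt ℝ (fun s ↦ K (α s)) t := by
    intro t ht
    have hKd : MDifferentiableAt I 𝓘(ℝ, E) K (α t) :=
      (hKs.contMDiffAt (hWo.mem_nhds (hαW ht))).mdifferentiableAt (by simp)
    exact mdifferentiableAt_iff_differentiableAt.1 (hKd.comp t (hα t ht).1)
  set β' : ℝ → E := fun t ↦ L (deriv (fun s ↦ K (α s)) t) with hβ'
  have hβd : ∀ t ∈ Icc a b, HasDerivAt β (β' t) t := fun t ht ↦
    L.hasFDerivAt.comp_hasDerivAt t (hdiff t ht).hasDerivAt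
  have hβdom : ∀ t ∈ Icc a b, (β t : TangentSpace I o) ∈ expDomain cov o := fun t ht ↦
    (hSdom _ (hΞ o hoW (α t) (hαW ht)).1).2
  have hexpβ : ∀ t ∈ Icc a b, (fun s ↦ expMap cov o (β s)) =ᶠ[𝓝 t] α := fun t ht ↦ by
    filter_upwards [hαnear t ht] with s hs
    exact (hΞ o hoW (α s) hs).2
  have hvelβ : ∀ t ∈ Icc a b, velocity I (fun s ↦ expMap cov o (β s)) t = velocity I α t := fun t ht ↦
    velocity_congr_of_eventuallyEq (I := I) (hexpβ t ht)
  have hβfut : ∀ t ∈ Icc a b, τ.IsFutureDirected (velocity I (fun s ↦ expMap cov o (β s)) t) := by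
    intro t ht
    rw [hvelβ t ht, (hexpβ t ht).eq_of_nhds]
    exact (hα t ht).2.2
  have ha : a ∈ Icc a b := left_mem_Icc.2 hab.le
  have hβa : β a = 0 := by
    show L (Ξ o (α a)) = 0
    rw [hαa, hΞoo, map_zero]
  -- `β' a = α' a` is future timelike (`d(exp_o)_0 = id`)
  have transportT : ∀ {x y : M} (w : E), x = y →
      (g.IsTimelike (x := x) w ↔ g.IsTimelike (x := y) w) := by
    rintro x y w rfl; exact Iff.rfl
  have transportF : ∀ {x y : M} (w : E), x = y →
      (τ.IsFutureDirected (x := x) w ↔ τ.IsFutureDirected (x := y) w) := by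
    rintro x y w rfl; exact Iff.rfl
  have hpt : expMap cov o (β a) = o := (hexpβ a ha).eq_of_nhds.trans hαa
  have hvel_a : (velocity I (fun s ↦ expMap cov o (β s)) a : E) = β' a :=
    velocity_expMap_comp_of_eq_zero (cov := cov) o (hβd a ha) hβa
  have hTa : g.IsTimelike (x := o) (β' a) ∧ τ.IsFutureDirected (x := o) (β' a) := by
    have h1 : g.IsTimelike (velocity I α a) := (hα a ha).2.1
    have h2 : τ.IsFutureDirected (velocity I α a) := (hα a ha).2.2
    have h3 : (velocity I α a : E) = β' a := by rw [← hvelβ a ha]; exact hvel_a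
    rw [← h3]
    exact ⟨(transportT (velocity I α a : E) hαa).1 h1, (transportF (velocity I α a : E) hαa).1 h2⟩
  -- `β` enters the open future timecone right after `a`
  set C : Set E := {w : E | g.IsTimelike (x := o) w ∧ τ.IsFutureDirected (x := o) w} with hC
  have hCo : IsOpen C := τ.isOpen_setOf_isTimelike_and_isFutureDirected o
  obtain ⟨a', ha', ha'b, hβa'⟩ : ∃ a', a < a' ∧ a' < b ∧ β a' ∈ C := by
    have hslope : Tendsto (slope β a) (𝓝[≠] a) (𝓝 (β' a)) :=
      hasDerivAt_iff_tendsto_slope.1 (hβd a ha)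
    have hev : ∀ᶠ t in 𝓝[>] a, slope β a t ∈ C :=
      (hslope.mono_left (nhdsGT_le_nhdsNE a)) (hCo.mem_nhds hTa)
    have hev' : ∀ᶠ t in 𝓝[>] a, t < b := by
      filter_upwards [Ioo_mem_nhdsGT hab] with t ht using ht.2
    obtain ⟨a', ⟨ha'C, ha'b⟩, ha'⟩ := ((hev.and hev').and self_mem_nhdsWithin).exists
    refine ⟨a', ha', ha'b, ?_⟩
    have hpos : 0 < a' - a := sub_pos.2 ha'
    have hβa' : β a' = (a' - a) • slope β a a' := by
      rw [slope_def_module, smul_smul, mul_inv_cancel₀ hpos.ne', one_smul, hβa, sub_zero]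
    rw [hβa']
    exact ⟨ha'C.1.smul hpos.ne', ha'C.2.smul hpos⟩
  -- Lemma 5.33 on `[a', b]`: `β b` is future timelike
  have hsub : Icc a' b ⊆ Icc a b := Icc_subset_Icc ha'.le le_rfl
  obtain ⟨hcone, -⟩ := radial_timecone_invariance τ hn (fun t ht ↦ hβd t (hsub ht))
    (fun t ht ↦ hβdom t (hsub ht)) (fun t ht ↦ hβfut t (hsub ht)) hβa'.1 hβa'.2
  have hβb : g.IsTimelike (x := o) (β b) := (hcone b (right_mem_Icc.2 ha'b.le)).1
  -- but `β b = v` by injectivity of the two-point inverse, and `v` is null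
  have hb : b ∈ Icc a b := right_mem_Icc.2 hab.le
  have hxW : α b ∈ W := hαW hb
  have hΞx : Ξ o (α b) = ξ := by
    have h1 : (o, Ξ o (α b)) ∈ Src := (hΞ o hoW (α b) hxW).1
    have heq : (fun w : M × E ↦ (w.1, expMap cov w.1 (e.symmL ℝ w.1 w.2))) (o, Ξ o (α b)) =
        (fun w : M × E ↦ (w.1, expMap cov w.1 (e.symmL ℝ w.1 w.2))) (o, ξ) := by
      simp only
      rw [(hΞ o hoW (α b) hxW).2, hξv, hαb]
    exact congrArg Prod.snd (hinjF h1 hv heq)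
  have hβbv : β b = v := by
    show L (Ξ o (α b)) = v
    rw [hΞx]; exact hξv
  rw [hβbv] at hβb
  exact absurd hvnull.1 hβb.ne

/-! ## The Kerr exterior (registered sub-goal) -/

/-- **Registered sub-goal `stub_noC0_kerrNullNotChronological`** (NoC0KerrChart programme): in the Kerr
exterior spacetime, locally, no future timelike curve runs from `o` to a point `exp_o v` with `v` null and
small (`exists_nhds_not_timelike_to_expMap_null` specialised). [cite: ONeillSemiRiemannian1983, Ch. 14, Lemma 14.2 (p. 402)] -/
theorem stub_noC0_kerrNullNotChronological : ∀ (M a : ℝ) [Kerr.Facts] [Kerr.SliceFacts] (hM : 0 ≤ M) (o : Kerr.exterior M a), ∃ (W : Set (Kerr.exterior M a)) (V : Set E4), IsOpen W ∧ o ∈ W ∧ V ∈ 𝓝 (0 : E4) ∧ ∀ v ∈ V, (v : TangentSpace 𝓘(ℝ, E4) o) ∈ Literature.Geometry.Riemannian.expDomain (Kerr.smoothMetric M a (Kerr.rPlus M a)).leviCivita o ∧ ((Kerr.smoothMetric M a (Kerr.rPlus M a)).IsNull (x := o) v → ∀ (α : ℝ → Kerr.exterior M a) (t₁ t₂ : ℝ),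 t₁ < t₂ → (Kerr.smoothMetric M a (Kerr.rPlus M a)).IsFutureTimelikeCurveOn (Kerr.exteriorSpacetime M a hM).timeOrientation α (Set.Icc t₁ t₂) → Set.MapsTo α (Set.Icc t₁ t₂) W → α t₁ = o → α t₂ = Literature.Geometry.Riemannian.expMap (Kerr.smoothMetric M a (Kerr.rPlus M a)).leviCivita o (v : TangentSpace 𝓘(ℝ, E4) o) → False) := by
  intro M a _ _ hM o
  haveI := LorentzianMetric.contMDiffCovariantDerivative_leviCivita_one (Kerr.smoothMetric M a (Kerr.rPlus M a))
  exact exists_nhds_not_timelike_to_expMap_null (g := Kerr.smoothMetric M a (Kerr.rPlus M a))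
    (Kerr.exteriorSpacetime M a hM).timeOrientation le_rfl o

end NoC0

end Summit.FinalStateConjecture.FinalStateConjecture.Theorems.PhaseMixingCaptureCaptureSufficesTame

end
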